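import Summits.BirchSwinnertonDyer.BirchSwinnertonDyer.Theorems.SmallImageMuTransferMuTransferX9StepsTwoFourTransportDistinguished
import HarnessLib

/-!
# Transport kit for `stub_stepsTwoFourOdd` (skeleton v6 of crux 19276 `MuTransferX9`), part 3: the
# ONE pair-transport theorem — the stub's conclusion at an arbitrary `(𝔓, Fr)` from the same conclusion
# at the distinguished local Frobenii of `ℚ_q`

Cell `b2b-bsdres` (X9 prover lineage, GEN 44) serving the K6 route `SmallImageMuTransfer` of cell
`bsd-smallim`. HONEST FRAMING: the cell deletes COMBINATION-SHAPED residual classes of the rank-≤1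
BSD formula from PUBLISHED theorems only and TYPES the construction-shaped remainder; this is not
"finishing BSD"; class X9 stays TYPED at class level. `--supports` helper toward the registered stub
`stub_stepsTwoFourOdd` of stmt-BirchSwinnertonDyer-19276 (skeleton v6, sha16 a90a661b046bb403); books
nothing, closes nothing; theorems only (no definition, no named fact).

Answer to x10 GEN 38's «G3 and G4 should both conclude at (𝔓₀, res Fr_q) and ONE pair-transport lemma
lifts to all (𝔓, Fr) — x9 g44, is that yours?» (bsd-smallim STATUS l.270 (3)).  Parts 1–2
(`…X9StepsTwoFourTransport`, p452883; `…Distinguished`, p453969) assembled in the stub's own currency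
(`W.modPTwist p κ J`, `W.modPTwist p κ.invTwist J`, cocycles `Φ`, `Ψc`, `convCoeff e J i`,
`aeval (shiftEnd _ J) U`, `shiftEnd _ J ^ m`), for ANY `Γ_ℚ`-equivariant pairing `e : E[p] × E[p] → P`
(k6-c2's `weilPairingHom W p eW …` with its `…_torsionGaloisModule_smul` is one):

**`exists_forall_convCoeff_aeval_eq_zero_of_forall_isAbsArithFrob`** — at a place `q ∤ p` where `E[p]`
is unramified, for cocycles `Φ`, `Ψc` vanishing on the (restricted) local inertia `I_{ℚ_q}` (their
classes are unramified at `q`: x10 `apply_absGaloisRestrict_eq_zero_of_localization_mem_unramified`),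
a prime `𝔓 ∣ q`, an arithmetic Frobenius `Fr` at `𝔓` with `ρ̄_{E,p}(Fr) = 1` and
`Fr ∈ Γ_n ∖ Γ_{n+1}` (`n + 1 ≤ J`), and exponents with `J ≤ m + pⁿ`: IF for every local arithmetic
Frobenius `r` of `ℚ_q` there is `U ∈ ℤ[X]` with `p ∤ U(0)` and
`C_i(U(S)·S^m·Φ(res r), Ψc(res r)) = 0` for all `i + ε < J`, THEN the same holds at `(Φ(Fr), Ψc(Fr))`
— the conclusion of `stub_stepsTwoFourOdd` VERBATIM (`J = 2e'+2`, `m = e'+1+a`, `pⁿ = e'+1`).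
Proof: one `t` for both cocycles (part 2 §3), the `(Fr − 1)`-ambiguities lie in `S^{pⁿ}·𝒯_J`
(part 1 `twistModP_apply_sub_self_mem_range_of_depth`), transport (part 1 §4).

PARTITION (D-0054): X9 (A4) · X10∧¬Surj (A5) at `p = 3` (`p` only enters through `Fact p.Prime`) —
hypothesis-discharging helper toward `stub_stepsTwoFourOdd`; closes NONE.

References: J.-P. Serre, *Local Fields*, I §8, VII §5 [SerreLocalFields1979]; J. Neukirch, *Algebraic
Number Theory*, II §9 (9.6) [NeukirchANT1999]; B. Mazur, K. Rubin, Mem. AMS 799 (2004) §1.3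
[MazurRubin2004]; L. Washington, *Cyclotomic Fields*, §13.2 [Washington1997]; HOME/koly/MU-TRANSFER-PROOF.md
§5 STEP 2 ("Another `𝔔` conjugates the pair …"; "`T^e`-ambiguities … harmless").
-/

-- the summit and its single problem are both named `BirchSwinnertonDyer` (registry layout D-0017)
set_option linter.dupNamespace false

set_option autoImplicit false

noncomputable section

open scoped NumberField
open Field WeierstrassCurve Literature.NumberTheory.EllipticCurves
  Literature.NumberTheory.GaloisRepresentations Function IsDedekindDomain NumberField Polynomial
open Literature.NumberTheory.GaloisRepresentations.IsNonarchimedeanLocalField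
open Literature.NumberTheory.Automorphic

namespace Summit.BirchSwinnertonDyer.BirchSwinnertonDyer.Rank1Residual.StepsTwoFourTransport

variable (W : WeierstrassCurve ℚ) (p : ℕ) [Fact p.Prime] (κ : ZpExtension ℚ p)
  {P : Type} [AddCommGroup P] [TopologicalSpace P] [DiscreteTopology P]
  (ρP : DiscreteGaloisModule ℚ P)
  {e : geomTorsion W (p : ℤ) →+ geomTorsion W (p : ℤ) →+ P}
  (he : ∀ (g : absoluteGaloisGroup ℚ) (m m' : geomTorsion W (p : ℤ)),
    e (g • m) (g • m') = ρP g (e m m'))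

/-- The local inertia group of `ℚ_q` (through the fixed embedding) fixes `𝒯_J(E, κ₁)` when `E[p]` is
unramified at `q` and `q ∤ p` (koly `toLocal_twistModP_apply_of_mem_absInertia`, `TopRep` spelling;
any `κ₁`, so also `κ.invTwist`). [cite: Washington1997, Prop. 13.2] -/
theorem toTopRep_ρ_absGaloisRestrict_apply_eq_self_of_mem_absInertia (κ₁ : ZpExtension ℚ p) {J : ℕ}
    {q : HeightOneSpectrum (𝓞 ℚ)} (hqp : ((p : ℕ) : 𝓞 ℚ) ∉ q.asIdeal)
    (hur : GaloisRep.IsUnramifiedAt q (W.torsionGaloisModule (p : ℤ)))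
    {i : absoluteGaloisGroup (q.adicCompletion ℚ)} (hi : i ∈ absInertia (q.adicCompletion ℚ))
    (x : (W.modPTwist p κ₁ J).toTopRep) :
    (W.modPTwist p κ₁ J).toTopRep.ρ (absGaloisRestrict ℚ (q.adicCompletion ℚ) i) x = x :=
  LocalSplitPrime.toLocal_twistModP_apply_of_mem_absInertia (W.torsionGaloisModule (p : ℤ))
    (fun Q => AddSubgroup.torsionBy.nsmul Q) κ₁ J q hur hqp hi x

include he in
/-- **The ONE pair-transport theorem for `stub_stepsTwoFourOdd`.**  See the module docstring.  At a
finite place `q ∤ p` of `ℚ` where `E[p]` is unramified, let `Φ`, `Ψc` be continuous `1`-cocycles of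
`𝒯_J(E, κ)`, `𝒯_J(E, κ⁻¹)` vanishing on the restricted local inertia `res(I_{ℚ_q})` (unramified
classes), `𝔓 ∣ q`, `Fr` an arithmetic Frobenius at `𝔓` with `ρ̄_{E,p}(Fr) = 1`,
`Fr ∈ Gal(ℚ̄/ℚ_n) ∖ Gal(ℚ̄/ℚ_{n+1})`, `n + 1 ≤ J ≤ m + pⁿ`.  If the stub's conclusion
`∃ U, p ∤ U(0) ∧ ∀ i, i + ε < J → C_i(U(S)·S^m·x, y) = 0` holds at `(x, y) = (Φ(res r), Ψc(res r))` for
every local arithmetic Frobenius `r` of `ℚ_q`, it holds at `(Φ(Fr), Ψc(Fr))`.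
[cite: SerreLocalFields1979, Ch. I §8 and VII §5] [cite: NeukirchANT1999, Ch. II §9 Prop. (9.6)]
[cite: MazurRubin2004, §1.3 and §5.3] [cite: Washington1997, §13.2 (arithmetic in Λ/(p, T^n))] -/
theorem exists_forall_convCoeff_aeval_eq_zero_of_forall_isAbsArithFrob {J n m ε : ℕ}
    (hnJ : n + 1 ≤ J) (hJm : J ≤ m + p ^ n)
    (Φ : contOneCocycles (W.modPTwist p κ J).toTopRep)
    (Ψc : contOneCocycles (W.modPTwist p κ.invTwist J).toTopRep)
    {q : HeightOneSpectrum (𝓞 ℚ)} (hqp : ((p : ℕ) : 𝓞 ℚ) ∉ q.asIdeal)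
    (hur : GaloisRep.IsUnramifiedAt q (W.torsionGaloisModule (p : ℤ)))
    (hΦI : ∀ i ∈ absInertia (q.adicCompletion ℚ),
      Φ.1 (absGaloisRestrict ℚ (q.adicCompletion ℚ) i) = 0)
    (hΨI : ∀ i ∈ absInertia (q.adicCompletion ℚ),
      Ψc.1 (absGaloisRestrict ℚ (q.adicCompletion ℚ) i) = 0)
    {𝔓 : Ideal (absIntegers (𝓞 ℚ) ℚ)} (h𝔓 : 𝔓 ∈ q.primesAbove) {Fr : absoluteGaloisGroup ℚ}
    (hFr : IsArithFrobAt (𝓞 ℚ) Fr 𝔓) (hρ : galoisRepTorsion W p Fr = 1)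
    (hFrn : Fr ∈ κ.layerSubgroup n) (hFrn' : Fr ∉ κ.layerSubgroup (n + 1))
    (hloc : ∀ r : absoluteGaloisGroup (q.adicCompletion ℚ), IsAbsArithFrob r →
      ∃ U : ℤ[X], ¬ (p : ℤ) ∣ U.coeff 0 ∧ ∀ i, i + ε < J →
        convCoeff e J i
          (aeval (shiftEnd (geomTorsion W (p : ℤ)) J) U
            ((shiftEnd (geomTorsion W (p : ℤ)) J ^ m)
              (Φ.1 (absGaloisRestrict ℚ (q.adicCompletion ℚ) r))))
          (Ψc.1 (absGaloisRestrict ℚ (q.adicCompletion ℚ) r)) = 0) :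
    ∃ U : ℤ[X], ¬ (p : ℤ) ∣ U.coeff 0 ∧ ∀ i, i + ε < J →
      convCoeff e J i
        (aeval (shiftEnd (geomTorsion W (p : ℤ)) J) U ((shiftEnd (geomTorsion W (p : ℤ)) J ^ m) (Φ.1 Fr)))
        (Ψc.1 Fr) = 0 := by
  -- a local Frobenius and the common translate `t`
  obtain ⟨r, hr⟩ := exists_isAbsArithFrob_holds (q.adicCompletion ℚ)
  obtain ⟨t, ht⟩ := exists_forall_apply_eq_smul_apply_absGaloisRestrict_sub (R := ℤ) h𝔓 hFr
  have hΦ := ht (W.modPTwist p κ J).toTopRep Φ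
    (fun i hi x => toTopRep_ρ_absGaloisRestrict_apply_eq_self_of_mem_absInertia W p κ hqp hur hi x)
    hΦI r hr
  have hΨ := ht (W.modPTwist p κ.invTwist J).toTopRep Ψc
    (fun i hi x =>
      toTopRep_ρ_absGaloisRestrict_apply_eq_self_of_mem_absInertia W p κ.invTwist hqp hur hi x)
    hΨI r hr
  -- `Fr` fixes `E[p]`: the `(Fr − 1)`-ambiguities lie in `S^{pⁿ}·𝒯_J`
  have hρ' : W.torsionGaloisModule (p : ℤ) Fr = 1 :=
    LinearMap.ext fun Q => by
      rw [torsionGaloisModule_apply_apply]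
      exact forall_smul_eq_of_galoisRepTorsion_eq_one W p hρ Q
  have hx : Φ.1 Fr - (W.modPTwist p κ J).toTopRep.ρ t
      (Φ.1 (absGaloisRestrict ℚ (q.adicCompletion ℚ) r)) ∈
      LinearMap.range (shiftEnd (geomTorsion W (p : ℤ)) J ^ (p ^ n)) := by
    rw [hΦ, sub_sub_cancel_left]
    exact Submodule.neg_mem _ (twistModP_apply_sub_self_mem_range_of_depth κ
      (W.torsionGaloisModule (p : ℤ)) (fun Q => AddSubgroup.torsionBy.nsmul Q) J hρ' hnJ hFrn hFrn'
      (Φ.1 t))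
  have hy : Ψc.1 Fr - (W.modPTwist p κ.invTwist J).toTopRep.ρ t
      (Ψc.1 (absGaloisRestrict ℚ (q.adicCompletion ℚ) r)) ∈
      LinearMap.range (shiftEnd (geomTorsion W (p : ℤ)) J ^ (p ^ n)) := by
    rw [hΨ, sub_sub_cancel_left]
    exact Submodule.neg_mem _ (twistModP_apply_sub_self_mem_range_of_depth κ.invTwist
      (W.torsionGaloisModule (p : ℤ)) (fun Q => AddSubgroup.torsionBy.nsmul Q) J hρ' hnJ
      ((ZpExtension.layerSubgroup_invTwist κ n).symm ▸ hFrn)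
      ((ZpExtension.layerSubgroup_invTwist κ (n + 1)).symm ▸ hFrn') (Ψc.1 t))
  -- transport
  exact exists_forall_convCoeff_aeval_eq_zero_of_translate κ (W.torsionGaloisModule (p : ℤ))
    (W.torsionGaloisModule (p : ℤ)) ρP (fun Q => AddSubgroup.torsionBy.nsmul Q)
    (fun Q => AddSubgroup.torsionBy.nsmul Q) J
    (fun g a b => by rw [torsionGaloisModule_apply_apply, torsionGaloisModule_apply_apply, he])
    hJm t hx hy (hloc r hr)

end Summit.BirchSwinnertonDyer.BirchSwinnertonDyer.Rank1Residual.StepsTwoFourTransport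

end

/-! ## Append no. 1: the same with ONE given local Frobenius `r` (the value `Φ(res r)` does not depend
on the choice of `r`, so the stub prover may work with the Frobenius it already has) -/

noncomputable section

open scoped NumberField
open Field WeierstrassCurve Literature.NumberTheory.EllipticCurves
  Literature.NumberTheory.GaloisRepresentations Function IsDedekindDomain NumberField Polynomial
open Literature.NumberTheory.GaloisRepresentations.IsNonarchimedeanLocalField
open Literature.NumberTheory.Automorphic

namespace Summit.BirchSwinnertonDyer.BirchSwinnertonDyer.Rank1Residual.StepsTwoFourTransport

variable (W : WeierstrassCurve ℚ) (p : ℕ) [Fact p.Prime] (κ : ZpExtension ℚ p)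
  {P : Type} [AddCommGroup P] [TopologicalSpace P] [DiscreteTopology P]
  (ρP : DiscreteGaloisModule ℚ P)
  {e : geomTorsion W (p : ℤ) →+ geomTorsion W (p : ℤ) →+ P}
  (he : ∀ (g : absoluteGaloisGroup ℚ) (m m' : geomTorsion W (p : ℤ)),
    e (g • m) (g • m') = ρP g (e m m'))

include he in
/-- **The pair-transport theorem with ONE given local Frobenius.**  As
`exists_forall_convCoeff_aeval_eq_zero_of_forall_isAbsArithFrob`, but the local hypothesis is asked at
a SINGLE arithmetic Frobenius `r` of `ℚ_q` (the one at which G3's Kolyvagin class, the `q`-term of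
Lemma 1 (iii) and the PT vanishing were evaluated): if
`∃ U, p ∤ U(0) ∧ ∀ i, i + ε < J → C_i(U(S)·S^m·Φ(res r), Ψc(res r)) = 0`, then the same holds at
`(Φ(Fr), Ψc(Fr))` for every prime `𝔓 ∣ q` and every arithmetic Frobenius `Fr` at `𝔓` with
`ρ̄_{E,p}(Fr) = 1`, `Fr ∈ Γ_n ∖ Γ_{n+1}` (`n + 1 ≤ J ≤ m + pⁿ`) — the conclusion of
`stub_stepsTwoFourOdd` verbatim. [cite: SerreLocalFields1979, Ch. I §8 and VII §5]
[cite: NeukirchANT1999, Ch. II §9 Prop. (9.6)] [cite: MazurRubin2004, §1.3 and §5.3]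
[cite: Washington1997, §13.2 (arithmetic in Λ/(p, T^n))] -/
theorem exists_forall_convCoeff_aeval_eq_zero_of_isAbsArithFrob {J n m ε : ℕ}
    (hnJ : n + 1 ≤ J) (hJm : J ≤ m + p ^ n)
    (Φ : contOneCocycles (W.modPTwist p κ J).toTopRep)
    (Ψc : contOneCocycles (W.modPTwist p κ.invTwist J).toTopRep)
    {q : HeightOneSpectrum (𝓞 ℚ)} (hqp : ((p : ℕ) : 𝓞 ℚ) ∉ q.asIdeal)
    (hur : GaloisRep.IsUnramifiedAt q (W.torsionGaloisModule (p : ℤ)))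
    (hΦI : ∀ i ∈ absInertia (q.adicCompletion ℚ),
      Φ.1 (absGaloisRestrict ℚ (q.adicCompletion ℚ) i) = 0)
    (hΨI : ∀ i ∈ absInertia (q.adicCompletion ℚ),
      Ψc.1 (absGaloisRestrict ℚ (q.adicCompletion ℚ) i) = 0)
    {r : absoluteGaloisGroup (q.adicCompletion ℚ)} (hr : IsAbsArithFrob r)
    (hloc : ∃ U : ℤ[X], ¬ (p : ℤ) ∣ U.coeff 0 ∧ ∀ i, i + ε < J →
        convCoeff e J i
          (aeval (shiftEnd (geomTorsion W (p : ℤ)) J) U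
            ((shiftEnd (geomTorsion W (p : ℤ)) J ^ m)
              (Φ.1 (absGaloisRestrict ℚ (q.adicCompletion ℚ) r))))
          (Ψc.1 (absGaloisRestrict ℚ (q.adicCompletion ℚ) r)) = 0)
    {𝔓 : Ideal (absIntegers (𝓞 ℚ) ℚ)} (h𝔓 : 𝔓 ∈ q.primesAbove) {Fr : absoluteGaloisGroup ℚ}
    (hFr : IsArithFrobAt (𝓞 ℚ) Fr 𝔓) (hρ : galoisRepTorsion W p Fr = 1)
    (hFrn : Fr ∈ κ.layerSubgroup n) (hFrn' : Fr ∉ κ.layerSubgroup (n + 1)) :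
    ∃ U : ℤ[X], ¬ (p : ℤ) ∣ U.coeff 0 ∧ ∀ i, i + ε < J →
      convCoeff e J i
        (aeval (shiftEnd (geomTorsion W (p : ℤ)) J) U ((shiftEnd (geomTorsion W (p : ℤ)) J ^ m) (Φ.1 Fr)))
        (Ψc.1 Fr) = 0 := by
  obtain ⟨t, ht⟩ := exists_forall_apply_eq_smul_apply_absGaloisRestrict_sub (R := ℤ) h𝔓 hFr
  have hΦ := ht (W.modPTwist p κ J).toTopRep Φ
    (fun i hi x => toTopRep_ρ_absGaloisRestrict_apply_eq_self_of_mem_absInertia W p κ hqp hur hi x)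
    hΦI r hr
  have hΨ := ht (W.modPTwist p κ.invTwist J).toTopRep Ψc
    (fun i hi x =>
      toTopRep_ρ_absGaloisRestrict_apply_eq_self_of_mem_absInertia W p κ.invTwist hqp hur hi x)
    hΨI r hr
  have hρ' : W.torsionGaloisModule (p : ℤ) Fr = 1 :=
    LinearMap.ext fun Q => by
      rw [torsionGaloisModule_apply_apply]
      exact forall_smul_eq_of_galoisRepTorsion_eq_one W p hρ Q
  have hx : Φ.1 Fr - (W.modPTwist p κ J).toTopRep.ρ t
      (Φ.1 (absGaloisRestrict ℚ (q.adicCompletion ℚ) r)) ∈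
      LinearMap.range (shiftEnd (geomTorsion W (p : ℤ)) J ^ (p ^ n)) := by
    rw [hΦ, sub_sub_cancel_left]
    exact Submodule.neg_mem _ (twistModP_apply_sub_self_mem_range_of_depth κ
      (W.torsionGaloisModule (p : ℤ)) (fun Q => AddSubgroup.torsionBy.nsmul Q) J hρ' hnJ hFrn hFrn'
      (Φ.1 t))
  have hy : Ψc.1 Fr - (W.modPTwist p κ.invTwist J).toTopRep.ρ t
      (Ψc.1 (absGaloisRestrict ℚ (q.adicCompletion ℚ) r)) ∈
      LinearMap.range (shiftEnd (geomTorsion W (p : ℤ)) J ^ (p ^ n)) := by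
    rw [hΨ, sub_sub_cancel_left]
    exact Submodule.neg_mem _ (twistModP_apply_sub_self_mem_range_of_depth κ.invTwist
      (W.torsionGaloisModule (p : ℤ)) (fun Q => AddSubgroup.torsionBy.nsmul Q) J hρ' hnJ
      ((ZpExtension.layerSubgroup_invTwist κ n).symm ▸ hFrn)
      ((ZpExtension.layerSubgroup_invTwist κ (n + 1)).symm ▸ hFrn') (Ψc.1 t))
  exact exists_forall_convCoeff_aeval_eq_zero_of_translate κ (W.torsionGaloisModule (p : ℤ))
    (W.torsionGaloisModule (p : ℤ)) ρP (fun Q => AddSubgroup.torsionBy.nsmul Q)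
    (fun Q => AddSubgroup.torsionBy.nsmul Q) J
    (fun g a b => by rw [torsionGaloisModule_apply_apply, torsionGaloisModule_apply_apply, he])
    hJm t hx hy hloc

/-- **The unramified value is independent of the local Frobenius**: two arithmetic Frobenii of
`ℚ_q` differ by local inertia, so a cocycle vanishing on `res(I_{ℚ_q})` with values in a module fixed
by it takes the SAME value at both (`IsAbsArithFrob.mul_inv_mem_absInertia`-free proof through the
distinguished prime: both are Frobenii at `𝔓₀`). [cite: SerreLocalFields1979, Ch. I §8 and VII §5] -/
theorem apply_absGaloisRestrict_eq_of_isAbsArithFrob {R : Type} [Ring R] [TopologicalSpace R]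
    (X : TopRep.{0} R (absoluteGaloisGroup ℚ)) (Φ : contOneCocycles X) {q : HeightOneSpectrum (𝓞 ℚ)}
    (hIX : ∀ i ∈ absInertia (q.adicCompletion ℚ), ∀ x : X,
      X.ρ (absGaloisRestrict ℚ (q.adicCompletion ℚ) i) x = x)
    (hI0 : ∀ i ∈ absInertia (q.adicCompletion ℚ), Φ.1 (absGaloisRestrict ℚ (q.adicCompletion ℚ) i) = 0)
    {r r' : absoluteGaloisGroup (q.adicCompletion ℚ)} (hr : IsAbsArithFrob r) (hr' : IsAbsArithFrob r') :
    Φ.1 (absGaloisRestrict ℚ (q.adicCompletion ℚ) r') = Φ.1 (absGaloisRestrict ℚ (q.adicCompletion ℚ) r) := by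
  have hres : IsArithFrobAt (𝓞 ℚ) (absGaloisRestrict ℚ (q.adicCompletion ℚ) r)
      (adicCompletionPrime ℚ q) :=
    (isArithFrobAt_absGaloisRestrict_adicCompletionPrime_iff ℚ q
      (by rw [residueFieldCard_adicCompletion_eq ℚ q, HeightOneSpectrum.residueCard_eq_card_quotient])
      r).2 hr
  have hres' : IsArithFrobAt (𝓞 ℚ) (absGaloisRestrict ℚ (q.adicCompletion ℚ) r')
      (adicCompletionPrime ℚ q) :=
    (isArithFrobAt_absGaloisRestrict_adicCompletionPrime_iff ℚ q
      (by rw [residueFieldCard_adicCompletion_eq ℚ q, HeightOneSpectrum.residueCard_eq_card_quotient])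
      r').2 hr'
  have hmem : absGaloisRestrict ℚ (q.adicCompletion ℚ) r * (absGaloisRestrict ℚ (q.adicCompletion ℚ) r')⁻¹ ∈
      (absInertia (q.adicCompletion ℚ)).map (absGaloisRestrict ℚ (q.adicCompletion ℚ)).toMonoidHom := by
    rw [← inertia_adicCompletionPrime_eq_map_absInertia]
    exact hres.mul_inv_mem_inertia hres'
  refine apply_eq_of_mul_inv_mem_of_forall_apply_eq_zero Φ
    (I := (absInertia (q.adicCompletion ℚ)).map (absGaloisRestrict ℚ (q.adicCompletion ℚ)).toMonoidHom)
    ?_ ?_ hmem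
  · rintro j ⟨i, hi, rfl⟩ x
    exact hIX i hi x
  · rintro j ⟨i, hi, rfl⟩
    exact hI0 i hi

end Summit.BirchSwinnertonDyer.BirchSwinnertonDyer.Rank1Residual.StepsTwoFourTransport

end
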